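import Literature.NumberTheory.EllipticCurves.HeegnerEnvelopeLevelwiseProofs
import Literature.NumberTheory.EllipticCurves.LambdaAdicSelmerDataProofs
import HarnessLib

/-!
# The Heegner-module envelope, UNIT-TWISTED hand-over: a `Λ`-unit twist of the levelwise `κ`-line
# membership suffices (group-ring elements `Σ cᵢ γ^i` of unit augmentation act invertibly Λ-adically;
# proofs file)

Topic `NumberTheory/EllipticCurves`. THEOREMS ONLY (no definition, no named fact, no `sorry`); sequel of
`HeegnerEnvelopeLevelwiseProofs` (levelwise ⟹ Λ-adic). Written by the cell `bsd-print-x9` seat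
`bsd-line-x9-p2` for the stub `stub_envelopeTied` of crux stmt-BirchSwinnertonDyer-26359
`PrintX9.HowardContainmentLightFramePinnedOfPrint` (aside twin 25235). The geometric half of the envelope
(coherent Heegner points + vertical distribution relations, seat x9-p1) delivers the `κ`-line membership of
the generators only UP TO a group-ring factor `λ = Σᵢ cᵢ γ^i ∈ ℤ_p[Gal(K_k/K)]` of UNIT AUGMENTATION
(`Σ cᵢ ∈ ℤ_pˣ`; e.g. Hecke/Cassini polynomials in `a_p` and `γ`, cf. the anomalous factor `(α − 1)²`):
`λ ⋆ (p^e · δ(w)) ∈ ℤ_p[G_k]·κ_k`. Since `ℤ_p[G_k]` is local, `λ` is a unit there; the present file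
realises the inversion WITHOUT group-ring theory, Λ-ADICALLY: `λ` is the level-`k` shadow
(`proj_sum_C_mul_one_add_X_pow_smul`) of the power series `f = Σᵢ C(cᵢ)(1+T)^i ∈ Λ`, whose constant
coefficient `Σ cᵢ` is a unit, so `f ∈ Λˣ` (`PowerSeries.isUnit_iff_constantCoeff`) and
`f • t ∈ Λκ_∞ ⟹ t ∈ Λκ_∞` in the `Λ`-module `𝔖` (`Submodule.smul_mem_iff'`).

WHAT.
* §1 `proj_one_add_X_pow_smul`: `proj_k ((1+T)^i • s) = conj_{γ^i} (proj_k s)`;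
  `proj_sum_C_mul_one_add_X_pow_smul`: `proj_k ((Σᵢ C(cᵢ)(1+T)^i) • s) = Σᵢ cᵢ·conj_{γ^i}(proj_k s)`;
  `constantCoeff_sum_C_mul_one_add_X_pow`, `isUnit_sum_C_mul_one_add_X_pow`.
* §2 `pow_smul_heegnerModule_le_stabilizedHeegnerModule_of_unit_twisted`: if `f ∈ Λ` is a unit and, for every
  spanning family `s` of `ℋ_∞(F)` and every `k > δ`, `proj_k (f • (p^e • s)) ∈ ℤ_p[G_k]·κ_k(C)`, then
  `(p^e) • ℋ_∞(F) ≤ Λκ_∞(C)`; and the group-ring corollary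
  `pow_smul_heegnerModule_le_stabilizedHeegnerModule_of_groupRing_twisted` (hypothesis
  `Σᵢ cᵢ·conj_{γ^i}(p^e • proj_k s) ∈ ℤ_p[G_k]·κ_k`, `IsUnit (Σ cᵢ)`).
HONEST FRAMING: bookkeeping only (the twist must be ONE element of `Λ`, the same at every layer; a
layer-dependent twist needs the `ω_k`-reduction, not done here); nothing about any particular curve; BSD is
not proved by any of this.

References: [CastellaGrossiLeeSkinner2022] Rem. 4.1.4; [PerrinRiou1987BSMF] §0 p. 402 (`𝔖_p` as a
`Λ = ℤ_p⟦Gal⟧`-module), §3.4; [Washington1997] §13.2 (units of `Λ`: unit constant term); [Howard2004HeegnerKolyvagin] §3.3.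
-/

set_option autoImplicit false

noncomputable section

open scoped Classical Pointwise

open WeierstrassCurve Literature.NumberTheory.EllipticCurves
  Literature.NumberTheory.EllipticCurves.CastellaGrossiLeeSkinner2022 PowerSeries

universe u

namespace Literature.NumberTheory.EllipticCurves

/-! ## §1 Group-ring elements of `Λ` and their level-`k` shadows -/

section GroupRing

variable {K : Type u} [Field K] [NumberField K] {W : WeierstrassCurve K} {p : ℕ} [Fact p.Prime]
  {κ : ZpExtension K p} {γ : Field.absoluteGaloisGroup K} (D : W.LambdaAdicSelmerData κ γ)

/-- `(1 + T)^i` acts levelwise as `conj_{γ^i}` (`T ↦ conj_γ − 1`, `proj_X`).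
[cite: PerrinRiou1987BSMF, §0 p. 402 (𝔖_p as a ℤ_p⟦Gal⟧-module, γ ↦ 1 + T)] -/
theorem proj_one_add_X_pow_smul (n i : ℕ) (s : D.S) :
    D.proj n (((1 + PowerSeries.X : IwasawaAlgebra p) ^ i) • s) =
      W.conjPi p (κ.layerSubgroup n) (γ ^ i) (D.proj n s) := by
  induction i generalizing s with
  | zero =>
    rw [pow_zero, one_smul, pow_zero]
    funext m
    simp only [conjPi, AddMonoidHom.pi_apply, AddMonoidHom.coe_comp, Function.comp_apply,
      Pi.evalAddMonoidHom_apply]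
    rw [conjH1_one_holds, AddMonoidHom.id_apply]
  | succ i ih =>
    rw [pow_succ', mul_smul, add_smul, one_smul, map_add, D.proj_X, ih, pow_succ', conjPi_mul]
    abel

/-- The level-`n` shadow of the group-ring element `Σ_{i ∈ S} C(cᵢ)(1+T)^i ∈ Λ` is
`Σᵢ cᵢ · conj_{γ^i}` (`proj_C`, `proj_one_add_X_pow_smul`). [cite: PerrinRiou1987BSMF, §0 p. 402] -/
theorem proj_sum_C_mul_one_add_X_pow_smul (n : ℕ) (S : Finset ℕ) (c : ℕ → ℤ_[p]) (s : D.S) :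
    D.proj n ((∑ i ∈ S, (PowerSeries.C (c i) : IwasawaAlgebra p) * (1 + PowerSeries.X) ^ i) • s) =
      ∑ i ∈ S, W.padicPi p (κ.layerSubgroup n) (c i)
        (W.conjPi p (κ.layerSubgroup n) (γ ^ i) (D.proj n s)) := by
  rw [Finset.sum_smul, map_sum]
  refine Finset.sum_congr rfl fun i _ ↦ ?_
  rw [mul_smul, D.proj_C, proj_one_add_X_pow_smul]

omit [NumberField K] in
/-- The constant coefficient (augmentation) of `Σ_{i ∈ S} C(cᵢ)(1+T)^i` is `Σ cᵢ`.
[cite: Washington1997, §13.2 (Λ = ℤ_p⟦T⟧, γ ↦ 1 + T)] -/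
theorem constantCoeff_sum_C_mul_one_add_X_pow (S : Finset ℕ) (c : ℕ → ℤ_[p]) :
    PowerSeries.constantCoeff (∑ i ∈ S, (PowerSeries.C (c i) : IwasawaAlgebra p) * (1 + PowerSeries.X) ^ i) =
      ∑ i ∈ S, c i := by
  rw [map_sum]
  refine Finset.sum_congr rfl fun i _ ↦ ?_
  rw [map_mul, map_pow, map_add, PowerSeries.constantCoeff_C, map_one, PowerSeries.constantCoeff_X,
    add_zero, one_pow, mul_one]

omit [NumberField K] in
/-- **Unit augmentation ⟹ unit of `Λ`**: `Σ_{i ∈ S} C(cᵢ)(1+T)^i ∈ Λˣ` as soon as `Σ cᵢ ∈ ℤ_pˣ` (a power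
series is a unit iff its constant coefficient is). [cite: Washington1997, §13.2 (units of Λ)] -/
theorem isUnit_sum_C_mul_one_add_X_pow (S : Finset ℕ) (c : ℕ → ℤ_[p]) (hc : IsUnit (∑ i ∈ S, c i)) :
    IsUnit (∑ i ∈ S, (PowerSeries.C (c i) : IwasawaAlgebra p) * (1 + PowerSeries.X) ^ i) := by
  rw [PowerSeries.isUnit_iff_constantCoeff, constantCoeff_sum_C_mul_one_add_X_pow]
  exact hc

end GroupRing

/-! ## §2 The unit-twisted hand-over -/

section Twist

variable {N : ℕ} [NeZero N] {W : WeierstrassCurve ℚ} [W.IsGloballyMinimal] {K : Type u} [Field K]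
  [NumberField K] {p : ℕ} [Fact p.Prime] {κ : ZpExtension K p} {γ : Field.absoluteGaloisGroup K}
  {jbar : AlgebraicClosure K →+* ℂ} (D : (W.baseChange K).LambdaAdicSelmerData κ γ)
  (F : HeegnerFamily N W K κ jbar) (C : StabilizedHeegnerData N W K κ jbar) (e : ℕ)

/-- **Unit-twisted levelwise membership ⟹ the envelope.** If `f ∈ Λ` is a unit and for every spanning
family `s` of `ℋ_∞(F)` (all level projections in the `ℋ̄_k`) and every layer `k > δ` the projection of
`f • (p^e • s)` lies in `ℤ_p[Gal(K_k/K)]·κ_k(C)`, then `(p^e) • ℋ_∞(F) ≤ Λκ_∞(C)`: `f • (p^e • s) ∈ Λκ_∞(C)` by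
the membership test, and `Λκ_∞(C)` is a `Λ`-submodule, so the unit `f` cancels (`Submodule.smul_mem_iff'`).
[cite: CastellaGrossiLeeSkinner2022, Rem. 4.1.4 («generate the same Λ-submodule»)] [cite: PerrinRiou1987BSMF, §3.4] -/
theorem pow_smul_heegnerModule_le_stabilizedHeegnerModule_of_unit_twisted {f : IwasawaAlgebra p}
    (hf : IsUnit f)
    (hlev : ∀ (s : D.S), (∀ j, D.proj j s ∈ heegnerModuleLayer γ F j) → ∀ (k : ℕ) (hk : C.depth < k),
      D.proj k (f • (((p : IwasawaAlgebra p) ^ e) • s)) ∈ stabilizedModuleLayer γ C k hk) :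
    ((p : IwasawaAlgebra p) ^ e) • heegnerModule D F ≤ stabilizedHeegnerModule D C := by
  obtain ⟨u, rfl⟩ := hf
  intro t ht
  obtain ⟨s, hs, rfl⟩ := (Submodule.mem_smul_pointwise_iff_exists _ _ _).mp ht
  clear ht
  unfold heegnerModule at hs
  induction hs using Submodule.span_induction with
  | mem g hg =>
    have hmem : (u : IwasawaAlgebra p) • (((p : IwasawaAlgebra p) ^ e) • g) ∈ stabilizedHeegnerModule D C :=
      mem_stabilizedHeegnerModule_of_proj_mem D C (hlev g hg)
    exact (Submodule.smul_mem_iff' _ u).mp (by rwa [Units.smul_def])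
  | zero => rw [smul_zero]; exact Submodule.zero_mem _
  | add a b _ _ ha hb => rw [smul_add]; exact Submodule.add_mem _ ha hb
  | smul r a _ ha => rw [smul_comm]; exact Submodule.smul_mem _ r ha

/-- **Group-ring form of the hand-over.** Let `λ = Σ_{i ∈ S} cᵢ γ^i` have unit augmentation
(`Σ cᵢ ∈ ℤ_pˣ`). If for every spanning family `s` of `ℋ_∞(F)` and every `k > δ`,
`λ ⋆ (p^e • proj_k s) := Σᵢ cᵢ · conj_{γ^i}(p^e • proj_k s)` lies in `ℤ_p[Gal(K_k/K)]·κ_k(C)`, then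
`(p^e) • ℋ_∞(F) ≤ Λκ_∞(C)` — the form in which the geometric half (coherent Heegner points, vertical
distribution relations, Kummer linearity) delivers the `κ`-line membership of the generators up to an
augmentation-unit factor. [cite: CastellaGrossiLeeSkinner2022, Rem. 4.1.4] [cite: Howard2004HeegnerKolyvagin, §3.3 (H_k as a ℤ_p[Gal(K_k/K)]-module)] -/
theorem pow_smul_heegnerModule_le_stabilizedHeegnerModule_of_groupRing_twisted (S : Finset ℕ)
    (c : ℕ → ℤ_[p]) (hc : IsUnit (∑ i ∈ S, c i))
    (hlev : ∀ (s : D.S), (∀ j, D.proj j s ∈ heegnerModuleLayer γ F j) → ∀ (k : ℕ) (hk : C.depth < k),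
      (∑ i ∈ S, (W.baseChange K).padicPi p (κ.layerSubgroup k) (c i)
        ((W.baseChange K).conjPi p (κ.layerSubgroup k) (γ ^ i)
          (((p : ℤ) ^ e) • D.proj k s))) ∈ stabilizedModuleLayer γ C k hk) :
    ((p : IwasawaAlgebra p) ^ e) • heegnerModule D F ≤ stabilizedHeegnerModule D C := by
  refine pow_smul_heegnerModule_le_stabilizedHeegnerModule_of_unit_twisted D F C e
    (isUnit_sum_C_mul_one_add_X_pow S c hc) fun s hs k hk ↦ ?_
  have hC : ((p : IwasawaAlgebra p) ^ e) = (PowerSeries.C ((((p : ℤ) ^ e : ℤ)) : ℤ_[p]) : IwasawaAlgebra p) := by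
    rw [Int.cast_pow, Int.cast_natCast, map_pow, map_natCast]
  rw [proj_sum_C_mul_one_add_X_pow_smul, hC, D.proj_C_intCast_smul]
  exact hlev s hs k hk

end Twist

end Literature.NumberTheory.EllipticCurves

end
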